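import Summits.Ventures.PercRepro.SixFourResidueFourGenericTable
import Summits.Ventures.PercRepro.SixFourResidueFourGenericTail
import Summits.Ventures.PercRepro.SixFourResidueClausesThree

/-!
# PercRepro — C-025 at `(6,4)`: THEOREM G HOLDS — `GenericFour` and `GenericFourBig` discharged (p3, gen 11 — §21.13)

Mine-2's Theorem G (§21.13: `0 ≤ J₄(G)` for every generic rank-`4` set `G ⊆ E` of a simple matroid with `g ≥ 10`
points, NO bound on the plane sizes) is now kernel-checked end to end: the identity route of
`SixFourResidueFourGenericA` / `…All` (`J_four_nonneg_of_generic_of_perPair`), the integer table for `10 ≤ g ≤ 100`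
(`SixFourResidueFourGenericTable`, `perPair4_of_range`) and the two-regime tail for `g ≥ 101`
(`SixFourResidueFourGenericTail`, `perPair4_tail_forall`, §21.21).  Hence **`perPairTail4_holds : PerPairTail4`**,
**`genericFour_holds : GenericFour`** and **`genericFourBig_holds : GenericFourBig`** — the first of the five open
`Prop`s of the residue of record (`SixFourResidueBigPlane.lean`) is discharged, and the big-plane clause reads
**`bigPlaneClause_of_two : PlaneAddTwoFour → PlaneLineFourBig → BigPlaneClause`**; `SixFourResidue`, hence C-025 at
`(6,4)` on every finite matroid, reduces to `TypeThreeSmall ∧ TwentyOnePrime ∧ PlaneAddTwoFour ∧ PlaneLineFourBig`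
(`sixFourResidue_of_four_pieces`, `rls_six_four_of_four_pieces`).
-/

namespace PercRepro.SixFour

open Finset ThmH PerFlat ThmN

/-- **The `g ≥ 101` tail of the per-pair inequality holds** (§21.21, `perPair4_tail_forall`). -/
theorem perPairTail4_holds : PerPairTail4 := perPair4_tail_forall

/-- **Theorem G (§21.13) holds**: `0 ≤ J₄(G)` for every generic rank-`4` set `G ⊆ E` of a simple matroid with at
least `10` points — no bound on the planes. -/
theorem genericFour_holds : GenericFour := genericFour_of_perPairTail4 perPairTail4_holds

/-- **Theorem G beyond Theorem 22 holds**: the big-plane residue `GenericFourBig` is discharged. -/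
theorem genericFourBig_holds : GenericFourBig := genericFourBig_of_perPairTail4 perPairTail4_holds

/-- **Theorem G on a solid**: `0 ≤ J₄(G)` for every generic rank-`4` set with `g ≥ 10`, in hypothesis form. -/
theorem J_four_nonneg_of_generic_all {α : Type} [DecidableEq α] {M : Matroid α} [M.Finite] {G : Finset α}
    (hs : Simple M) (hG : G ⊆ gr M) (hr : M.eRk (G : Set α) = 4) (hgen : Generic M G) (hg : 10 ≤ G.card) :
    0 ≤ J M G 4 :=
  genericFour_holds M G hs hG hr hgen hg

/-- **The big-plane clause from its two remaining pieces.** -/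
theorem bigPlaneClause_of_two (hβ : PlaneAddTwoFour) (hγ : PlaneLineFourBig) : BigPlaneClause :=
  bigPlaneClause_of genericFourBig_holds hβ hγ

/-- **Theorem 22′ from its two remaining pieces.** -/
theorem twentyTwoPrime_of_two (hβ : PlaneAddTwoFour) (hγ : PlaneLineFour) : TwentyTwoPrime :=
  twentyTwoPrime_of genericFour_holds hβ hγ

/-- **`SixFourResidue` from the four remaining pieces of record.** -/
theorem sixFourResidue_of_four_pieces (h3s : TypeThreeSmall) (h3b : TwentyOnePrime) (hβ : PlaneAddTwoFour)
    (hγ : PlaneLineFourBig) : SixFourResidue :=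
  sixFourResidue_of_three_clauses h3s h3b (bigPlaneClause_of_two hβ hγ)

/-- **C-025 at `(6, 4)` on every finite matroid from the four remaining pieces of record**: `RLS M 6 4`. -/
theorem rls_six_four_of_four_pieces {α : Type} (h3s : TypeThreeSmall) (h3b : TwentyOnePrime) (hβ : PlaneAddTwoFour)
    (hγ : PlaneLineFourBig) (M : Matroid α) [M.Finite] : RLS M 6 4 :=
  rls_six_four_of_residue (sixFourResidue_of_four_pieces h3s h3b hβ hγ) M

end PercRepro.SixFour
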